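import Summits.CriticalPhenomena.PercolationContinuityZ3.Theorems.PercNearOneGluingNoHeavyPcintChordRandWinSites
import Summits.CriticalPhenomena.PercolationContinuityZ3.Theorems.PercNearOneGluingNoHeavyPcintChordRandReduction
import HarnessLib

/-!
# PCINT lane: window certificates for the B3r (`chordrand_cw`) weight — kernel form

Cell `prim-pcint`, seat `prim-pcint-2`; memo `run/shared/lean/prim/pcint/REDUCTIONS.md` §R2, §B3r.1–2, §B3r.6.
Does NOT build on p205010.

For a self-avoiding word `γ` of length `m + 1 + k` and the causal window automaton of memory `m + 2` with
transition weight `p · ((1-p)·r)^{c} · s̄^{gw} · κ̄^{[cw]}` (`c` visible chords at the new vertex, refund `r ≥ 1/s`,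
`gw` window gap sites, `cw` window corner flag — all SOUNDLY under-counted), the full-information B3r weight
`chordRandWeight p s γ` is at most `p^{m+1} · run` (per step: `gapFactor_mul_le_winFactor`; chords: the on-path
events are paid by the visible chords' refunds and the invisible chords' slack, `card_onEvents_le`,
`sum_winChordTrue_eq`).  Result: `le_criticalProb_zd_of_chordRandWindowCert : … → p ≤ p_c^bond(ℤ^d)`.
-/

noncomputable section

namespace Summit.CriticalPhenomena.PercolationContinuityZ3.Theorems.Pcint

open Finset Literature.Probability.Percolation Literature.Probability.LatticeModels

variable {d m : ℕ} (a₀ : Fin d × Bool)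

/-! ### The per-step domination -/

/-- **Per-step domination for kind `chordrand`**: for a self-avoiding word, the full B3r factor at time
`t + m + 2` times `s^{#on-path events at t}` is at most the window automaton's factor `s̄^{gw} κ̄^{[cw]}` whenever
`gw ≤ winGapTrue`, `cw → WinCornerTrue`, `0 ≤ s ≤ s̄ ≤ 1`, `(1+s̄)/2 ≤ κ̄`. [folklore] -/
theorem gapFactor_mul_le_winFactor {k : ℕ} {γ : Fin (m + 1 + k) → Fin d × Bool} (hs : IsSAW γ)
    {t : ℕ} (ht : t < k) {gw : ℕ} {cw : Bool}
    (hgw : gw ≤ winGapTrue (winAt (m := m + 1) a₀ γ t) (wordAt a₀ γ (t + (m + 1))))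
    (hcw : cw = true → WinCornerTrue (winAt (m := m + 1) a₀ γ t) (wordAt a₀ γ (t + (m + 1))))
    {s sb κb : ℝ} (hs0 : 0 ≤ s) (hsb : s ≤ sb) (hsb1 : sb ≤ 1) (hκb : (1 + sb) / 2 ≤ κb) :
    gapFactor s ((1 + s) / 2) γ (t + m + 2) * s ^ ((onEvents m γ).filter fun th => th.1 = t).card ≤
      sb ^ gw * (if cw then κb else 1) := by
  classical
  have hsb0 : 0 ≤ sb := hs0.trans hsb
  have hs1 : s ≤ 1 := hsb.trans hsb1
  have hsκ : s ≤ κb := by linarith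
  have hκ0 : (0 : ℝ) ≤ (1 + s) / 2 := by linarith
  have hκ1 : (1 + s) / 2 ≤ 1 := by linarith
  set W := winGapSet (winAt (m := m + 1) a₀ γ t) (wordAt a₀ γ (t + (m + 1))) with hW
  set goff := (W.filter fun w' => w' + wordPos γ t ∉ pathSites γ).card with hgoff
  set gon := (W.filter fun w' => w' + wordPos γ t ∈ pathSites γ).card with hgon
  set e := ((onEvents m γ).filter fun th => th.1 = t).card with he
  have hsplit : winGapTrue (winAt (m := m + 1) a₀ γ t) (wordAt a₀ γ (t + (m + 1))) = gon + goff := by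
    unfold winGapTrue
    rw [hgon, hgoff, hW]
    exact (Finset.card_filter_add_card_filter_not _).symm
  have hgoff_le : goff ≤ (gapSet γ (t + m + 2)).card := card_offWin_le a₀ ht
  have hgon_le : gon ≤ e := by
    have := card_onWin_le (γ := γ) a₀ ht false (fun h => Bool.noConfusion h)
    simpa using this
  -- generic bounds
  have hpow_g : s ^ (gapSet γ (t + m + 2)).card ≤ s ^ goff := pow_le_pow_of_le_one hs0 hs1 hgoff_le
  have hpow_e : s ^ e ≤ s ^ gon := pow_le_pow_of_le_one hs0 hs1 hgon_le
  have hwin : s ^ goff * s ^ gon ≤ sb ^ gw := by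
    rw [← pow_add, show goff + gon = gon + goff by ring, ← hsplit]
    exact (pow_le_pow_of_le_one hs0 hs1 hgw).trans (pow_le_pow_left₀ hs0 hsb _)
  have hgf0 : 0 ≤ s ^ (gapSet γ (t + m + 2)).card := pow_nonneg hs0 _
  unfold gapFactor
  rw [show t + m + 2 - 2 = t + m by omega]
  -- the corner-free bound: `s^g · κ^c · s^e ≤ s^goff · s^gon`
  have hbase : s ^ (gapSet γ (t + m + 2)).card * (if 2 ≤ t + m + 2 ∧ IsCorner γ (t + m) then (1 + s) / 2 else 1)
      * s ^ e ≤ s ^ goff * s ^ gon := by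
    have h1 : s ^ (gapSet γ (t + m + 2)).card * (if 2 ≤ t + m + 2 ∧ IsCorner γ (t + m) then (1 + s) / 2 else 1)
        ≤ s ^ goff := by
      split_ifs
      · exact (mul_le_of_le_one_right hgf0 hκ1).trans hpow_g
      · rw [mul_one]; exact hpow_g
    exact mul_le_mul h1 hpow_e (pow_nonneg hs0 _) (pow_nonneg hs0 _)
  cases cw
  · simp only [Bool.false_eq_true, if_false, mul_one]
    exact hbase.trans hwin
  · simp only [if_true]
    have hwc := hcw rfl
    by_cases hcon : cornerSite γ (t + m) ∈ pathSites γ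
    · -- corner site on the path: one more on-path event pays the coin
      have hgon1 : gon + 1 ≤ e := by
        have := card_onWin_le (γ := γ) a₀ ht true (fun _ => ⟨hwc, hcon⟩)
        simpa using this
      have h1 : s ^ (gapSet γ (t + m + 2)).card * (if 2 ≤ t + m + 2 ∧ IsCorner γ (t + m) then (1 + s) / 2 else 1)
          ≤ s ^ goff := by
        split_ifs
        · exact (mul_le_of_le_one_right hgf0 hκ1).trans hpow_g
        · rw [mul_one]; exact hpow_g
      calc _ ≤ s ^ goff * s ^ (gon + 1) :=
            mul_le_mul h1 (pow_le_pow_of_le_one hs0 hs1 hgon1) (pow_nonneg hs0 _) (pow_nonneg hs0 _)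
        _ = s ^ goff * s ^ gon * s := by rw [pow_succ]; ring
        _ ≤ sb ^ gw * κb := mul_le_mul hwin hsκ hs0 (pow_nonneg hsb0 _)
    · by_cases hcor : IsCorner γ (t + m)
      · rw [if_pos ⟨by omega, hcor⟩]
        calc s ^ (gapSet γ (t + m + 2)).card * ((1 + s) / 2) * s ^ e
            = s ^ (gapSet γ (t + m + 2)).card * s ^ e * ((1 + s) / 2) := by ring
          _ ≤ s ^ goff * s ^ gon * κb :=
              mul_le_mul (mul_le_mul hpow_g hpow_e (pow_nonneg hs0 _) (pow_nonneg hs0 _)) (by linarith) hκ0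
                (mul_nonneg (pow_nonneg hs0 _) (pow_nonneg hs0 _))
          _ ≤ sb ^ gw * κb := mul_le_mul_of_nonneg_right hwin (by linarith)
      · rw [if_neg (fun h => hcor h.2), mul_one]
        have hlt : goff < (gapSet γ (t + m + 2)).card := by
          rw [hgoff, hW]; exact card_offWin_lt a₀ hs ht hwc hcon hcor
        calc s ^ (gapSet γ (t + m + 2)).card * s ^ e ≤ s ^ (goff + 1) * s ^ gon :=
              mul_le_mul (pow_le_pow_of_le_one hs0 hs1 (by omega)) hpow_e (pow_nonneg hs0 _) (pow_nonneg hs0 _)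
          _ = s ^ goff * s ^ gon * s := by rw [pow_succ]; ring
          _ ≤ sb ^ gw * κb := mul_le_mul hwin hsκ hs0 (pow_nonneg hsb0 _)

/-! ### The product of the time factors -/

/-- The B3r weight as `pⁿ (1-p)^{#chords}` times the product of its time factors. [folklore] -/
theorem chordRandWeight_eq_prod (p s : ℝ) {n : ℕ} (γ : Fin n → Fin d × Bool) :
    chordRandWeight p s γ = p ^ n * (1 - p) ^ (chordEdges γ).card *
      ∏ T ∈ range (n + 1), gapFactor s ((1 + s) / 2) γ T := by
  classical
  unfold chordRandWeight gapFactor gapTotal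
  rw [prod_mul_distrib, prod_pow_eq_pow_sum, prod_ite, prod_const_one, mul_one, prod_const,
    card_filter_corner, mul_assoc]

/-! ### The certificate theorem -/

/-- **B3r window certificate ⇒ lower bound on `p_c^bond(ℤ^d)`** (kernel form of REDUCTIONS §R2.5 for kind
`chordrand_cw`, windows of `m + 1` steps).  Data: an acceptance test `ok` accepting every self-avoiding extended
window; computable counts `c ≤ winChordTrue`, `gw ≤ winGapTrue`, `cw → WinCornerTrue`; constants `0 < s ≤ s̄ ≤ 1`,
`s² ≥ 1 - p²`, `(1+s̄)/2 ≤ κ̄`, a refund factor `r ≥ 0` with `s·r ≥ 1` and `(1-p)·r ≤ 1`; and a positive vector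
`v` with the Collatz–Wielandt inequalities `Σ_a [ok u a] p ((1-p) r)^{c} s̄^{gw} κ̄^{[cw]} v(wshift u a) ≤ λ v(u)`,
`λ < 1`.  Then `p ≤ p_c^bond(ℤ^d)`. [folklore] -/
theorem le_criticalProb_zd_of_chordRandWindowCert (a₀ : Fin d × Bool)
    (ok : (Fin (m + 1) → Fin d × Bool) → Fin d × Bool → Bool) (c gw : (Fin (m + 1) → Fin d × Bool) → Fin d × Bool → ℕ)
    (cw : (Fin (m + 1) → Fin d × Bool) → Fin d × Bool → Bool)
    (hok : ∀ u a, IsSAW (wext u a) → ok u a = true)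
    (hc : ∀ u a, IsSAW (wext u a) → c u a ≤ winChordTrue u a)
    (hg : ∀ u a, IsSAW (wext u a) → gw u a ≤ winGapTrue u a)
    (hcn : ∀ u a, IsSAW (wext u a) → cw u a = true → WinCornerTrue u a)
    (p : unitInterval) {s sb κb r : ℝ} (hs0 : 0 < s) (hsb : s ≤ sb) (hsb1 : sb ≤ 1) (hκb : (1 + sb) / 2 ≤ κb)
    (hps : 1 - (p : ℝ) ^ 2 ≤ s ^ 2) (hr0 : 0 ≤ r) (hsr : 1 ≤ s * r) (hpr : (1 - (p : ℝ)) * r ≤ 1)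
    (v : (Fin (m + 1) → Fin d × Bool) → ℝ) {vmin vmax lam : ℝ} (hvmin : 0 < vmin)
    (hv : ∀ u, vmin ≤ v u) (hvmax : ∀ u, v u ≤ vmax) (hlam0 : 0 < lam) (hlam1 : lam < 1)
    (hcw : ∀ u, (∑ a : Fin d × Bool, if ok u a then
      (p : ℝ) * (((1 - p) * r) ^ c u a * (sb ^ gw u a * (if cw u a then κb else 1))) * v (wshift u a) else 0)
        ≤ lam * v u) :
    (p : ℝ) ≤ criticalProb (zdGraph d) 0 := by
  classical
  have hp0 : (0 : ℝ) ≤ p := p.2.1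
  have hp1 : (p : ℝ) ≤ 1 := p.2.2
  have hq0 : 0 ≤ 1 - (p : ℝ) := sub_nonneg.2 hp1
  have hsb0 : 0 ≤ sb := hs0.le.trans hsb
  have hs1 : s ≤ 1 := hsb.trans hsb1
  have hκ0 : (0 : ℝ) ≤ (1 + s) / 2 := by linarith
  have hκ1 : (1 + s) / 2 ≤ 1 := by linarith
  have hpr0 : 0 ≤ (1 - (p : ℝ)) * r := mul_nonneg hq0 hr0
  -- `(1-p) ≤ s²`
  have hps' : 1 - (p : ℝ) ≤ s ^ 2 := by nlinarith
  set wt : (Fin (m + 1) → Fin d × Bool) → Fin d × Bool → ℝ :=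
    fun u a => (p : ℝ) * (((1 - p) * r) ^ c u a * (sb ^ gw u a * (if cw u a then κb else 1))) with hwt
  have hwt0 : ∀ u a, 0 ≤ wt u a := fun u a => by
    rw [hwt]; dsimp only
    refine mul_nonneg hp0 (mul_nonneg (pow_nonneg hpr0 _) (mul_nonneg (pow_nonneg hsb0 _) ?_))
    split_ifs <;> linarith
  set M := windowAutW ok wt hwt0 with hM
  have hcw' : ∀ u, M.stepSum v u ≤ lam * v u := fun u => by rw [hM, stepSum_windowAutW]; exact hcw u
  have hdom : ∀ (k : ℕ) (γ : Fin (m + 1 + k) → Fin d × Bool), γ ∈ sawWords d (m + 1 + k) →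
      chordRandWeight p s γ ≤ (p : ℝ) ^ (m + 1) * M.run k (winAt a₀ γ 0) (fun j => γ ⟨m + 1 + j.1, by omega⟩) := by
    intro k γ hγ
    have hsaw : IsSAW γ := mem_sawWords.1 hγ
    have hwin : ∀ t < k, IsSAW (wext (winAt (m := m + 1) a₀ γ t) (wordAt a₀ γ (t + (m + 1)))) :=
      fun t ht => isSAW_wext_winAt a₀ hsaw (by omega)
    rw [hM, run_windowAutW_eq a₀ ok wt hwt0 k γ (fun t ht => hok _ _ (hwin t ht)), chordRandWeight_eq_prod,
      show m + 1 + k + 1 = (m + 2) + k by ring, Finset.prod_range_add]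
    -- notation for the sums along the windows
    set CV := ∑ t ∈ range k, winChordTrue (winAt (m := m + 1) a₀ γ t) (wordAt a₀ γ (t + (m + 1))) with hCV
    set E := (onEvents m γ).card with hE
    have hCVeq : CV = (visChords m γ).card := sum_winChordTrue_eq a₀ γ
    have hEle : E ≤ CV + 2 * (invChords m γ).card := by rw [hCVeq]; exact card_onEvents_le γ
    have hCH : CV + (invChords m γ).card ≤ (chordEdges γ).card := by
      rw [hCVeq, ← IsSAW.card_chordPairs_eq hsaw]; exact card_visChords_add_card_invChords_le γ
    -- (1) chords and on-path events: `(1-p)^CH · s^CV ≤ (1-p)^CV · s^E`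
    have hchords : (1 - (p : ℝ)) ^ (chordEdges γ).card * s ^ CV ≤ (1 - (p : ℝ)) ^ CV * s ^ E := by
      obtain ⟨D, hD⟩ : ∃ D, (chordEdges γ).card = CV + (invChords m γ).card + D :=
        ⟨(chordEdges γ).card - (CV + (invChords m γ).card), by omega⟩
      rw [hD, pow_add, pow_add]
      calc (1 - (p : ℝ)) ^ CV * (1 - (p : ℝ)) ^ (invChords m γ).card * (1 - (p : ℝ)) ^ D * s ^ CV
          ≤ (1 - (p : ℝ)) ^ CV * (s ^ 2) ^ (invChords m γ).card * 1 * s ^ CV :=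
            mul_le_mul_of_nonneg_right (mul_le_mul (mul_le_mul_of_nonneg_left
              (pow_le_pow_left₀ hq0 hps' _) (pow_nonneg hq0 _)) (pow_le_one₀ hq0 (by linarith))
              (pow_nonneg hq0 _) (mul_nonneg (pow_nonneg hq0 _) (pow_nonneg (sq_nonneg s) _))) (pow_nonneg hs0.le _)
        _ = (1 - (p : ℝ)) ^ CV * s ^ (CV + 2 * (invChords m γ).card) := by rw [← pow_mul, pow_add]; ring
        _ ≤ (1 - (p : ℝ)) ^ CV * s ^ E :=
            mul_le_mul_of_nonneg_left (pow_le_pow_of_le_one hs0.le hs1 hEle) (pow_nonneg hq0 _)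
    -- (2) gap/corner factors and on-path events: `∏ gapFactor · s^E ≤ ∏ s̄^gw κ̄^cw`
    have hE_fib : E = ∑ t ∈ range k, ((onEvents m γ).filter fun th => th.1 = t).card := by
      rw [hE]
      exact card_eq_sum_card_fiberwise fun th hth => by
        rw [mem_coe, mem_range]; exact (mem_onEvents.1 hth).1
    have hsteps : (∏ t ∈ range k, gapFactor s ((1 + s) / 2) γ (m + 2 + t)) * s ^ E ≤
        ∏ t ∈ range k, (sb ^ gw (winAt a₀ γ t) (wordAt a₀ γ (t + (m + 1))) *
          (if cw (winAt a₀ γ t) (wordAt a₀ γ (t + (m + 1))) then κb else 1)) := by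
      rw [hE_fib, ← prod_pow_eq_pow_sum, ← prod_mul_distrib]
      refine prod_le_prod (fun t _ => mul_nonneg (gapFactor_nonneg hs0.le hκ0 γ _) (pow_nonneg hs0.le _))
        fun t ht => ?_
      have ht' := mem_range.1 ht
      rw [show m + 2 + t = t + m + 2 by ring]
      exact gapFactor_mul_le_winFactor a₀ hsaw ht' (hg _ _ (hwin t ht')) (hcn _ _ (hwin t ht')) hs0.le hsb hsb1
        hκb
    -- (3) the window weights, split
    have hprod : ∏ t ∈ range k, wt (winAt a₀ γ t) (wordAt a₀ γ (t + (m + 1))) =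
        (p : ℝ) ^ k * ((∏ t ∈ range k, ((1 - (p : ℝ)) * r) ^ c (winAt a₀ γ t) (wordAt a₀ γ (t + (m + 1)))) *
          ∏ t ∈ range k, (sb ^ gw (winAt a₀ γ t) (wordAt a₀ γ (t + (m + 1))) *
            (if cw (winAt a₀ γ t) (wordAt a₀ γ (t + (m + 1))) then κb else 1))) := by
      rw [hwt, prod_mul_distrib, prod_const, card_range, prod_mul_distrib]
    -- the refund part: `(1-p)^CV · ((1-p) r)^{-…}`: `((1-p) r)^{c_t} ≥ ((1-p) r)^{cvis_t}` and `((1-p) r)^CV · s^CV ≥ (1-p)^CV`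
    have hrefund : (1 - (p : ℝ)) ^ CV ≤
        (∏ t ∈ range k, ((1 - (p : ℝ)) * r) ^ c (winAt a₀ γ t) (wordAt a₀ γ (t + (m + 1)))) * s ^ CV := by
      have h1 : (∏ t ∈ range k, ((1 - (p : ℝ)) * r) ^ winChordTrue (winAt (m := m + 1) a₀ γ t)
          (wordAt a₀ γ (t + (m + 1)))) ≤
          ∏ t ∈ range k, ((1 - (p : ℝ)) * r) ^ c (winAt a₀ γ t) (wordAt a₀ γ (t + (m + 1))) :=
        prod_le_prod (fun t _ => pow_nonneg hpr0 _) fun t ht =>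
          pow_le_pow_of_le_one hpr0 hpr (hc _ _ (hwin t (mem_range.1 ht)))
      have h2 : (∏ t ∈ range k, ((1 - (p : ℝ)) * r) ^ winChordTrue (winAt (m := m + 1) a₀ γ t)
          (wordAt a₀ γ (t + (m + 1)))) * s ^ CV = (1 - (p : ℝ)) ^ CV * (r * s) ^ CV := by
        rw [prod_pow_eq_pow_sum, ← hCV, mul_pow, mul_pow]; ring
      have h3 : (1 : ℝ) ≤ (r * s) ^ CV := one_le_pow₀ (by rw [mul_comm]; exact hsr)
      calc (1 - (p : ℝ)) ^ CV ≤ (1 - (p : ℝ)) ^ CV * (r * s) ^ CV := le_mul_of_one_le_right (pow_nonneg hq0 _) h3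
        _ = _ := h2.symm
        _ ≤ _ := mul_le_mul_of_nonneg_right h1 (pow_nonneg hs0.le _)
    -- assemble
    rw [hprod, show (p : ℝ) ^ (m + 1 + k) = (p : ℝ) ^ (m + 1) * (p : ℝ) ^ k by rw [pow_add]]
    have hfirst : (∏ T ∈ range (m + 2), gapFactor s ((1 + s) / 2) γ T) ≤ 1 :=
      prod_le_one (fun T _ => gapFactor_nonneg hs0.le hκ0 γ T) fun T _ => gapFactor_le_one hs0.le hs1 hκ0 hκ1 γ T
    have hPk : 0 ≤ ∏ t ∈ range k, gapFactor s ((1 + s) / 2) γ (m + 2 + t) :=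
      prod_nonneg fun T _ => gapFactor_nonneg hs0.le hκ0 γ _
    set A := ∏ t ∈ range k, ((1 - (p : ℝ)) * r) ^ c (winAt a₀ γ t) (wordAt a₀ γ (t + (m + 1))) with hA
    set B := ∏ t ∈ range k, (sb ^ gw (winAt a₀ γ t) (wordAt a₀ γ (t + (m + 1))) *
      (if cw (winAt a₀ γ t) (wordAt a₀ γ (t + (m + 1))) then κb else 1)) with hB
    set Pk := ∏ t ∈ range k, gapFactor s ((1 + s) / 2) γ (m + 2 + t) with hPkdef
    have hA0 : 0 ≤ A := prod_nonneg fun t _ => pow_nonneg hpr0 _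
    -- key real inequality: `(1-p)^CH · Pfirst · Pk ≤ A · B`, via multiplication by `s^CV > 0`
    have hsCV : 0 < s ^ CV := pow_pos hs0 _
    have hkey : (1 - (p : ℝ)) ^ (chordEdges γ).card * Pk ≤ A * B := by
      have h1 : (1 - (p : ℝ)) ^ (chordEdges γ).card * Pk * s ^ CV ≤ A * B * s ^ CV := by
        calc (1 - (p : ℝ)) ^ (chordEdges γ).card * Pk * s ^ CV
            = ((1 - (p : ℝ)) ^ (chordEdges γ).card * s ^ CV) * Pk := by ring
          _ ≤ ((1 - (p : ℝ)) ^ CV * s ^ E) * Pk := mul_le_mul_of_nonneg_right hchords hPk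
          _ = (1 - (p : ℝ)) ^ CV * (Pk * s ^ E) := by ring
          _ ≤ (A * s ^ CV) * B := mul_le_mul hrefund hsteps (mul_nonneg hPk (pow_nonneg hs0.le _))
              (mul_nonneg hA0 (pow_nonneg hs0.le _))
          _ = A * B * s ^ CV := by ring
      exact le_of_mul_le_mul_right h1 hsCV
    calc (p : ℝ) ^ (m + 1) * (p : ℝ) ^ k * (1 - (p : ℝ)) ^ (chordEdges γ).card *
          ((∏ T ∈ range (m + 2), gapFactor s ((1 + s) / 2) γ T) * Pk)
        ≤ (p : ℝ) ^ (m + 1) * (p : ℝ) ^ k * (1 - (p : ℝ)) ^ (chordEdges γ).card * (1 * Pk) := by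
          refine mul_le_mul_of_nonneg_left (mul_le_mul_of_nonneg_right hfirst hPk) ?_
          exact mul_nonneg (mul_nonneg (pow_nonneg hp0 _) (pow_nonneg hp0 _)) (pow_nonneg hq0 _)
      _ = (p : ℝ) ^ (m + 1) * (p : ℝ) ^ k * ((1 - (p : ℝ)) ^ (chordEdges γ).card * Pk) := by ring
      _ ≤ (p : ℝ) ^ (m + 1) * (p : ℝ) ^ k * (A * B) :=
          mul_le_mul_of_nonneg_left hkey (mul_nonneg (pow_nonneg hp0 _) (pow_nonneg hp0 _))
      _ = (p : ℝ) ^ (m + 1) * ((p : ℝ) ^ k * (A * B)) := by ring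
  obtain ⟨C, hC⟩ := sum_le_geometric_of_windowCertW a₀ ok wt hwt0 (fun n => sawWords d n)
    (fun n γ => chordRandWeight p s γ)
    (fun n γ _ => by
      unfold chordRandWeight
      exact mul_le_one₀ (mul_le_one₀ (mul_le_one₀ (pow_le_one₀ hp0 hp1) (pow_nonneg hq0 _)
        (pow_le_one₀ hq0 (by linarith))) (pow_nonneg hs0.le _) (pow_le_one₀ hs0.le hs1))
        (pow_nonneg hκ0 _) (pow_le_one₀ hκ0 hκ1))
    (pow_nonneg hp0 (m + 1)) (pow_le_one₀ hp0 hp1) hdom v hvmin hv hvmax hlam0 hcw'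
  exact le_criticalProb_zd_of_chordRand_le_geometric d p hs0.le hs1 hps hlam0.le hlam1 hC

end Summit.CriticalPhenomena.PercolationContinuityZ3.Theorems.Pcint
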